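import Summits.ValiantsHypothesis.ValiantsHypothesis.Theorems.KPlusLogSqLawTropicalSymmetricOrbitThreeFourLemmas

/-!
# Route «KPlusLogSqLaw» — the symmetric `(3,4)` tropical row in the ORBIT model — abstract exclusion lemmas, part 2:
# the pair-carrier cases of the orbit Lemma Y (`{0,1,3}, {0,2,3}, {1,1,2}, {1,2,2}` are not all carried)

HONEST FRAMING.  Helper file (seat val-sym-lift-p2 (g6), cell `pub-symmetroid`, 2026-08-27; `--supports` the `WeakLifting` item
stmt-ValiantsHypothesis-19561 as a helper, no closure claim).  A SMALL-FORMAT statement in the transpose-ORBIT carrier model, far inside the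
known regime of the cruxes; port blueprint `HOME/val-sym-lift-p2/g6/LEMMA-Z-liftp2g6.md` §6 (typed case tree `exp/casetree_Yorb.txt`).  Nothing
here is about `TropicalB` / `WeakLifting` in their windows, Conjecture B, DoorA34 = `PosRootLawAt 3 4 18` (OPEN, never asserted),
`MatrixDescartes` (stmt-ValiantsHypothesis-18050) or VP ≠ VNP; `TSymOrb34Le17` / `TSymOrb34Le16` stay targets (NOT asserted).

THIS FILE (hypotheses as in part 1, plus `hR2`/`hR2'` = transposition vs pair-carrier cancellation):
* `CC_low_high`: a pair carrier with all letters in `{1,2}` and a pair carrier with letters `0` and `3` cannot both occur (`CC_dominated`);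
* `TC_facts`: the monotone-letter and R2w / R2′w consequences between a cycle-constant transposition term and a pair carrier, with the
  orientation of the 3-cycle resolved;
* `K3`: `{0,1,3} = C`, `{1,1,2} = T`, `{1,2,2} = T` is impossible (both transpositions would sit on the pair where `C` reads `1`).
(`K1` / `K2` — two identity terms against a pair carrier — are in `…SymmetricOrbitThreeFourPairsDD`.)
[cell statement R1732; folklore-level exchange arguments, no citation exists]
-/

set_option linter.dupNamespace false
set_option autoImplicit false

namespace Summit.ValiantsHypothesis.ValiantsHypothesis.Theorems.KPlusLogSqLaw

open Summit.ValiantsHypothesis.ValiantsHypothesis.Theorems.MatrixDescartes.Negative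
open Summit.ValiantsHypothesis.ValiantsHypothesis.Theorems.LacunarySymmetroidMatrixDescartes
open Summit.ValiantsHypothesis.ValiantsHypothesis.Theorems.LacunarySymmetroidMatrixDescartes.TropicalCensus
open Finset

namespace SymmetricOrbitThreeFour

open SymmetricThreeFour SymmetricThreeFourSeventeen SymmetricThreeFourSixteen SymmetricThreeFourFifteen

/-- a fixed-point-free permutation of `Fin 3` maps one of two distinct points to the other. -/
theorem fpf_orient : ∀ σ : Equiv.Perm (Fin 3), (∀ i, σ i ≠ i) → ∀ i j : Fin 3, i ≠ j → σ i = j ∨ σ j = i := by decide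

/-- the rest of the 3-cycle once one step is known. -/
theorem fpf_next : ∀ σ : Equiv.Perm (Fin 3), (∀ i, σ i ≠ i) → ∀ i j k : Fin 3, i ≠ j → k ≠ i → k ≠ j → σ i = j → σ j = k ∧ σ k = i := by
  decide

/-! ## Two pair carriers with separated letters -/

/-- **`CC_low_high`.**  A fixed-point-free term all of whose letters are `1` or `2` and a fixed-point-free term carrying a `0` and a `3`
cannot both occur in the chain. [CC_dominated] -/
theorem CC_low_high {n : ℕ} (r : Fin (n + 1) → Equiv.Perm (Fin 3) × (Fin 3 → Fin 4))
    (hM : ∀ a b : Fin (n + 1), a < b → ∀ l₁ l₂ : Fin 3,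
      ((r a).1 l₁ = (r b).1 l₂ ∧ l₁ = l₂) ∨ ((r a).1 l₁ = l₂ ∧ (r b).1 l₂ = l₁) → (r a).2 l₁ ≤ (r b).2 l₂)
    (z y : Fin (n + 1)) (hz : ∀ i, (r z).1 i ≠ i) (hy : ∀ i, (r y).1 i ≠ i)
    (hzlo : ∀ l, (r z).2 l ≠ 0) (hzhi : ∀ l, (r z).2 l ≠ 3) (l0 l3 : Fin 3) (h0 : (r y).2 l0 = 0) (h3 : (r y).2 l3 = 3) : False := by
  have hzy : z ≠ y := by intro hq; rw [hq] at hzlo; exact hzlo l0 h0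
  rcases lt_or_gt_of_ne hzy with hlt | hlt
  · obtain ⟨φ, hφ⟩ := CC_dominated r hM z y hlt hz hy
    have hle := hφ (φ.symm l0)
    rw [Equiv.apply_symm_apply, h0] at hle
    exact hzlo _ (le_antisymm hle (Fin.zero_le _))
  · obtain ⟨φ, hφ⟩ := CC_dominated r hM y z hlt hy hz
    have hle := hφ l3
    rw [h3] at hle
    exact hzhi _ (le_antisymm (Fin.le_last _) hle)

/-! ## A cycle-constant transposition term against a pair carrier -/

/-- **`TC_facts`.**  `c` a transposition term `swap i j` (equal ranks on the pair, third column `k`), `a` a fixed-point-free term.  Then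
there are columns `l, m` with `{l, m} = {i, j}` such that `a`'s column `l` reads the cell of the pair `{i, j}` (`(r a).1 l = m`) and
(i) if `c < a`: `(r c).2 i ≤ (r a).2 l` and `g((r c).2 k) + g((r c).2 i) < g((r a).2 m) + g((r a).2 k)`;
(ii) if `a < c`: `(r a).2 l ≤ (r c).2 i` and `g((r a).2 m) + g((r a).2 k) < g((r c).2 k) + g((r c).2 i)`. [hM, hR2, hR2'] -/
theorem TC_facts {n : ℕ} (r : Fin (n + 1) → Equiv.Perm (Fin 3) × (Fin 3 → Fin 4)) (g : Fin 4 → ℕ)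
    (hM : ∀ a b : Fin (n + 1), a < b → ∀ l₁ l₂ : Fin 3,
      ((r a).1 l₁ = (r b).1 l₂ ∧ l₁ = l₂) ∨ ((r a).1 l₁ = l₂ ∧ (r b).1 l₂ = l₁) → (r a).2 l₁ ≤ (r b).2 l₂)
    (hR2 : ∀ a b : Fin (n + 1), a < b → ∀ i j k : Fin 3, i ≠ j → k ≠ i → k ≠ j → (r a).1 = Equiv.swap i j →
      (r a).2 i = (r a).2 j → (r b).1 i = j → (r b).1 j = k → (r b).1 k = i →
      g ((r a).2 k) + g ((r a).2 i) < g ((r b).2 j) + g ((r b).2 k))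
    (hR2' : ∀ a b : Fin (n + 1), a < b → ∀ i j k : Fin 3, i ≠ j → k ≠ i → k ≠ j → (r a).1 i = j → (r a).1 j = k → (r a).1 k = i →
      (r b).1 = Equiv.swap i j → (r b).2 i = (r b).2 j → g ((r a).2 j) + g ((r a).2 k) < g ((r b).2 k) + g ((r b).2 i))
    (c a : Fin (n + 1)) {i j k : Fin 3} (hij : i ≠ j) (hki : k ≠ i) (hkj : k ≠ j)
    (hc1 : (r c).1 = Equiv.swap i j) (hcc : (r c).2 i = (r c).2 j) (ha : ∀ x, (r a).1 x ≠ x) :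
    ∃ l m : Fin 3, ((l = i ∧ m = j) ∨ (l = j ∧ m = i)) ∧ (r a).1 l = m ∧
      (c < a → (r c).2 i ≤ (r a).2 l ∧ g ((r c).2 k) + g ((r c).2 i) < g ((r a).2 m) + g ((r a).2 k)) ∧
      (a < c → (r a).2 l ≤ (r c).2 i ∧ g ((r a).2 m) + g ((r a).2 k) < g ((r c).2 k) + g ((r c).2 i)) := by
  rcases fpf_orient (r a).1 ha i j hij with hor | hor
  · -- `σ i = j`: the pair `{i,j}` is read at column `i`; cycle `i ↦ j ↦ k ↦ i`
    obtain ⟨hjk, hki'⟩ := fpf_next (r a).1 ha i j k hij hki hkj hor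
    refine ⟨i, j, Or.inl ⟨rfl, rfl⟩, hor, fun hlt => ⟨?_, ?_⟩, fun hlt => ⟨?_, ?_⟩⟩
    · exact hM c a hlt i i (Or.inl ⟨by rw [hc1, Equiv.swap_apply_left, hor], rfl⟩)
    · exact hR2 c a hlt i j k hij hki hkj hc1 hcc hor hjk hki'
    · exact hM a c hlt i i (Or.inl ⟨by rw [hc1, Equiv.swap_apply_left, hor], rfl⟩)
    · exact hR2' a c hlt i j k hij hki hkj hor hjk hki' hc1 hcc
  · -- `σ j = i`: the pair is read at column `j`; cycle `j ↦ i ↦ k ↦ j`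
    obtain ⟨hik, hkj'⟩ := fpf_next (r a).1 ha j i k hij.symm hkj hki hor
    have hc1' : (r c).1 = Equiv.swap j i := by rw [hc1, Equiv.swap_comm]
    refine ⟨j, i, Or.inr ⟨rfl, rfl⟩, hor, fun hlt => ⟨?_, ?_⟩, fun hlt => ⟨?_, ?_⟩⟩
    · rw [hcc]; exact hM c a hlt j j (Or.inl ⟨by rw [hc1, Equiv.swap_apply_right, hor], rfl⟩)
    · rw [hcc]; exact hR2 c a hlt j i k hij.symm hkj hki hc1' hcc.symm hor hik hkj'
    · rw [hcc]; exact hM a c hlt j j (Or.inl ⟨by rw [hc1, Equiv.swap_apply_right, hor], rfl⟩)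
    · rw [hcc]; exact hR2' a c hlt j i k hij.symm hkj hki hor hik hkj' hc1' hcc.symm

/-! ## The three genuinely three-term configurations of the orbit Lemma Y -/

/-- the structure of a transposition term carrying `{x, y, y}` (`x ≠ y`): pair rank `y`, fixed rank `x` at the third column. -/
theorem swap_letters {n : ℕ} (r : Fin (n + 1) → Equiv.Perm (Fin 3) × (Fin 3 → Fin 4)) (c : Fin (n + 1)) {i j k : Fin 3}
    (hij : i ≠ j) (hki : k ≠ i) (hkj : k ≠ j) (hcc : (r c).2 i = (r c).2 j) (x y : Fin 4)
    (hcx : (univ.filter fun l => (r c).2 l = x).card = 1) (hcy : (univ.filter fun l => (r c).2 l = y).card = 2)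
    (honly : ∀ l, (r c).2 l = x ∨ (r c).2 l = y) : (r c).2 i = y ∧ (r c).2 k = x := by
  have hiy : (r c).2 i = y := by
    rcases honly i with h | h
    · exfalso
      have h2le := two_le_card_filter (r c) hij.symm hcc.symm
      rw [h, hcx] at h2le
      exact absurd h2le (by decide)
    · exact h
  refine ⟨hiy, ?_⟩
  rcases honly k with h | h
  · exact h
  · exfalso
    have hsub : ({i, j, k} : Finset (Fin 3)) ⊆ univ.filter fun l => (r c).2 l = y := by
      intro t ht
      simp only [mem_insert, mem_singleton] at ht
      rw [mem_filter]
      rcases ht with rfl | rfl | rfl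
      · exact ⟨mem_univ _, hiy⟩
      · exact ⟨mem_univ _, hcc ▸ hiy⟩
      · exact ⟨mem_univ _, h⟩
    have := card_le_card hsub
    rw [card_insert_of_notMem (by simp [hij, hki.symm]), card_pair hkj.symm, hcy] at this
    exact absurd this (by decide)

/-- **`K3`**: `{0,1,3}` carried by a pair carrier, `{1,1,2}` and `{1,2,2}` carried by transposition terms — impossible: both transpositions
are forced onto the pair where the pair carrier reads `1` (R2w / R2′w + the shared pair cell), and then fixed-entry / pair monotonicity
between them fails. [hM, hR2, hR2'] -/
theorem K3 {n : ℕ} (r : Fin (n + 1) → Equiv.Perm (Fin 3) × (Fin 3 → Fin 4)) (g : Fin 4 → ℕ) (hmono : Monotone g)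
    (hM : ∀ a b : Fin (n + 1), a < b → ∀ l₁ l₂ : Fin 3,
      ((r a).1 l₁ = (r b).1 l₂ ∧ l₁ = l₂) ∨ ((r a).1 l₁ = l₂ ∧ (r b).1 l₂ = l₁) → (r a).2 l₁ ≤ (r b).2 l₂)
    (hR2 : ∀ a b : Fin (n + 1), a < b → ∀ i j k : Fin 3, i ≠ j → k ≠ i → k ≠ j → (r a).1 = Equiv.swap i j →
      (r a).2 i = (r a).2 j → (r b).1 i = j → (r b).1 j = k → (r b).1 k = i →
      g ((r a).2 k) + g ((r a).2 i) < g ((r b).2 j) + g ((r b).2 k))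
    (hR2' : ∀ a b : Fin (n + 1), a < b → ∀ i j k : Fin 3, i ≠ j → k ≠ i → k ≠ j → (r a).1 i = j → (r a).1 j = k → (r a).1 k = i →
      (r b).1 = Equiv.swap i j → (r b).2 i = (r b).2 j → g ((r a).2 j) + g ((r a).2 k) < g ((r b).2 k) + g ((r b).2 i))
    (a c e : Fin (n + 1)) (ha : ∀ x, (r a).1 x ≠ x)
    (hca : TropicalCensus.classSym (r a) = TropicalCensus.classSym ((1 : Equiv.Perm (Fin 3)), (![0, 1, 3] : Fin 3 → Fin 4)))
    (hcc' : TropicalCensus.classSym (r c) = TropicalCensus.classSym ((1 : Equiv.Perm (Fin 3)), (![1, 1, 2] : Fin 3 → Fin 4)))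
    (hce : TropicalCensus.classSym (r e) = TropicalCensus.classSym ((1 : Equiv.Perm (Fin 3)), (![1, 2, 2] : Fin 3 → Fin 4)))
    {i j : Fin 3} (hij : i < j) (hc1 : (r c).1 = Equiv.swap i j) (hcc : (r c).2 i = (r c).2 j)
    {i' j' : Fin 3} (hij2 : i' < j') (he1 : (r e).1 = Equiv.swap i' j') (hee : (r e).2 i' = (r e).2 j') : False := by
  have ca : ∀ l, (univ.filter fun t => (r a).2 t = l).card = (![1, 1, 0, 1] : Fin 4 → ℕ) l :=
    fun l => (card_filter_eq_of_classSym_eq hca l).trans (cnt013 l)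
  have cc : ∀ l, (univ.filter fun t => (r c).2 t = l).card = (![0, 2, 1, 0] : Fin 4 → ℕ) l :=
    fun l => (card_filter_eq_of_classSym_eq hcc' l).trans (cnt112 l)
  have ce : ∀ l, (univ.filter fun t => (r e).2 t = l).card = (![0, 1, 2, 0] : Fin 4 → ℕ) l :=
    fun l => (card_filter_eq_of_classSym_eq hce l).trans (cnt122 l)
  have hac : a ≠ c := by intro h; have := ca 0; rw [h, cc 0] at this; exact absurd this (by decide)
  have hae : a ≠ e := by intro h; have := ca 0; rw [h, ce 0] at this; exact absurd this (by decide)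
  have ua2 : ∀ t, (r a).2 t ≠ 2 := ne_of_card_zero _ 2 (by rw [ca 2]; rfl)
  have g01 : g 0 ≤ g 1 := hmono (by decide)
  have g12 : g 1 ≤ g 2 := hmono (by decide)
  have g23 : g 2 ≤ g 3 := hmono (by decide)
  -- letters of the two transposition terms
  obtain ⟨k, hki, hkj⟩ := exists_third i j
  obtain ⟨k', hki', hkj'⟩ := exists_third i' j'
  have hij' : i ≠ j := ne_of_lt hij
  have hij2' : i' ≠ j' := ne_of_lt hij2
  have f4_q : ∀ x : Fin 4, x ≠ 0 → x ≠ 2 → x = 1 ∨ x = 3 := by decide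
  have f4_r : ∀ x : Fin 4, 1 ≤ x → x ≠ 2 → x ≠ 3 → x = 1 := by decide
  have f4_m : ∀ x : Fin 4, x ≤ 2 → x ≠ 2 → x ≤ 1 := by decide
  have c_only : ∀ l, (r c).2 l = 2 ∨ (r c).2 l = 1 := fun l => by
    by_cases h1 : (r c).2 l = 1
    · exact Or.inr h1
    · exact Or.inl (f4_j _ (ne_of_card_zero _ 0 (by rw [cc 0]; rfl) l) h1 (ne_of_card_zero _ 3 (by rw [cc 3]; rfl) l))
  have e_only : ∀ l, (r e).2 l = 1 ∨ (r e).2 l = 2 := fun l => by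
    by_cases h1 : (r e).2 l = 1
    · exact Or.inl h1
    · exact Or.inr (f4_j _ (ne_of_card_zero _ 0 (by rw [ce 0]; rfl) l) h1 (ne_of_card_zero _ 3 (by rw [ce 3]; rfl) l))
  obtain ⟨hci, hck⟩ := swap_letters r c hij' hki hkj hcc 2 1 (by rw [cc 2]; rfl) (by rw [cc 1]; rfl) c_only
  obtain ⟨hei, hek⟩ := swap_letters r e hij2' hki' hkj' hee 1 2 (by rw [ce 1]; rfl) (by rw [ce 2]; rfl) e_only
  -- letters of the pair carrier `a`: `0, 1, 3` once each
  have a_ne0 : ∀ {t t' : Fin 3}, (r a).2 t = 0 → t' ≠ t → (r a).2 t' ≠ 0 := fun h hne => ne_of_card_one _ 0 (by rw [ca 0]; rfl) h hne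
  have a_ne1 : ∀ {t t' : Fin 3}, (r a).2 t = 1 → t' ≠ t → (r a).2 t' ≠ 1 := fun h hne => ne_of_card_one _ 1 (by rw [ca 1]; rfl) h hne
  have a_ne3 : ∀ {t t' : Fin 3}, (r a).2 t = 3 → t' ≠ t → (r a).2 t' ≠ 3 := fun h hne => ne_of_card_one _ 3 (by rw [ca 3]; rfl) h hne
  -- if the column `l` of `a` carries `0`, the other two carry `1` and `3`
  have sum13 : ∀ l m t : Fin 3, l ≠ m → t ≠ l → t ≠ m → (r a).2 l = 0 → g ((r a).2 m) + g ((r a).2 t) = g 1 + g 3 := by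
    intro l m t hlm htl htm hl0
    have hm := f4_q _ (a_ne0 hl0 hlm.symm) (ua2 m)
    have ht := f4_q _ (a_ne0 hl0 htl) (ua2 t)
    rcases hm with hm | hm <;> rcases ht with ht | ht
    · exact absurd ht (a_ne1 hm htm)
    · rw [hm, ht]
    · rw [hm, ht, add_comm]
    · exact absurd ht (a_ne3 hm htm)
  -- the transposition `c` sits on the pair where `a` reads `1`
  obtain ⟨l, m, hlm, hσl, hlt1, hlt2⟩ := TC_facts r g hM hR2 hR2' c a hij' hki hkj hc1 hcc ha
  have hlmk : l ≠ m ∧ k ≠ l ∧ k ≠ m := by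
    rcases hlm with ⟨rfl, rfl⟩ | ⟨rfl, rfl⟩
    · exact ⟨hij', hki, hkj⟩
    · exact ⟨hij'.symm, hkj, hki⟩
  have hal1 : (r a).2 l = 1 := by
    rcases lt_or_gt_of_ne hac with hlt | hlt
    · obtain ⟨hle, hC⟩ := hlt2 hlt
      rw [hci, hck] at *
      by_contra hne
      have hl0 : (r a).2 l = 0 := f4_f _ hle hne
      have := sum13 l m k hlmk.1 hlmk.2.1 hlmk.2.2 hl0
      omega
    · obtain ⟨hle, hC⟩ := hlt1 hlt
      rw [hci, hck] at *
      by_contra hne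
      have hl3 : (r a).2 l = 3 := by
        by_contra h3
        exact hne (f4_r _ hle (ua2 l) h3)
      have gm : g ((r a).2 m) ≤ g 1 := hmono (f4_e _ (a_ne3 hl3 hlmk.1.symm) (ua2 m))
      have gk : g ((r a).2 k) ≤ g 1 := hmono (f4_e _ (a_ne3 hl3 hlmk.2.1) (ua2 k))
      omega
  -- the transposition `e` sits on the pair where `a` reads `1`, too
  obtain ⟨l', m', hlm', hσl', hlt1', hlt2'⟩ := TC_facts r g hM hR2 hR2' e a hij2' hki' hkj' he1 hee ha
  have hlmk' : l' ≠ m' ∧ k' ≠ l' ∧ k' ≠ m' := by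
    rcases hlm' with ⟨rfl, rfl⟩ | ⟨rfl, rfl⟩
    · exact ⟨hij2', hki', hkj'⟩
    · exact ⟨hij2'.symm, hkj', hki'⟩
  have hal1' : (r a).2 l' = 1 := by
    rcases lt_or_gt_of_ne hae with hlt | hlt
    · obtain ⟨hle, hC⟩ := hlt2' hlt
      rw [hei, hek] at *
      by_contra hne
      have hl0 : (r a).2 l' = 0 := f4_f _ (f4_m _ hle (ua2 l')) hne
      have := sum13 l' m' k' hlmk'.1 hlmk'.2.1 hlmk'.2.2 hl0
      omega
    · obtain ⟨hle, hC⟩ := hlt1' hlt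
      rw [hei, hek] at *
      have hl3 : (r a).2 l' = 3 := f4_d _ hle (ua2 l')
      have gm : g ((r a).2 m') ≤ g 1 := hmono (f4_e _ (a_ne3 hl3 hlmk'.1.symm) (ua2 m'))
      have gk : g ((r a).2 k') ≤ g 1 := hmono (f4_e _ (a_ne3 hl3 hlmk'.2.1) (ua2 k'))
      omega
  -- hence the same pair, the same transposition, the same fixed column
  have hll : l' = l := by
    by_contra hne
    exact a_ne1 hal1 hne hal1'
  have hmm : m' = m := by rw [← hσl', hll, hσl]
  have hperm : (r e).1 = (r c).1 := by
    rw [he1, hc1]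
    rcases hlm with ⟨h1, h2⟩ | ⟨h1, h2⟩ <;> rcases hlm' with ⟨h1', h2'⟩ | ⟨h1', h2'⟩
    · rw [← h1', hll, h1, ← h2', hmm, h2]
    · rw [← h2', hmm, h2, ← h1', hll, h1, Equiv.swap_comm]
    · rw [← h1', hll, h1, ← h2', hmm, h2, Equiv.swap_comm]
    · rw [← h2', hmm, h2, ← h1', hll, h1]
  have hkk : k' = k := by
    by_contra hne
    have hk'l : k' ≠ l := hll ▸ hlmk'.2.1
    have hk'm : k' ≠ m := hmm ▸ hlmk'.2.2
    rcases hlm with ⟨h1, h2⟩ | ⟨h1, h2⟩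
    · rcases eq_or_eq_of_ne_third i j k k' hij' hki.symm hkj.symm hne with h | h
      · exact hk'l (h.trans h1.symm)
      · exact hk'm (h.trans h2.symm)
    · rcases eq_or_eq_of_ne_third i j k k' hij' hki.symm hkj.symm hne with h | h
      · exact hk'm (h.trans h2.symm)
      · exact hk'l (h.trans h1.symm)
  -- monotonicity between the two transposition terms on the same carrier fails
  have hce' : c ≠ e := by intro h; have := cc 1; rw [h, ce 1] at this; exact absurd this (by decide)
  have hi_in : i = i' ∨ i = j' := by
    rcases hlm with ⟨h1, h2⟩ | ⟨h1, h2⟩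
    · rcases hlm' with ⟨h1', _⟩ | ⟨h1', _⟩
      · exact Or.inl (h1.symm.trans (hll.symm.trans h1'))
      · exact Or.inr (h1.symm.trans (hll.symm.trans h1'))
    · rcases hlm' with ⟨_, h2'⟩ | ⟨_, h2'⟩
      · exact Or.inr (h2.symm.trans (hmm.symm.trans h2'))
      · exact Or.inl (h2.symm.trans (hmm.symm.trans h2'))
  have hei2 : (r e).2 i = 2 := by
    rcases hi_in with h | h
    · rw [h]; exact hei
    · rw [h, ← hee]; exact hei
  rcases lt_or_gt_of_ne hce' with hlt | hlt
  · have hle := hM c e hlt k k (Or.inl ⟨by rw [hperm], rfl⟩)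
    rw [hck, ← hkk, hek] at hle
    exact absurd hle (by decide)
  · have hle := hM e c hlt i i (Or.inl ⟨by rw [hperm], rfl⟩)
    rw [hei2, hci] at hle
    exact absurd hle (by decide)

end SymmetricOrbitThreeFour

end Summit.ValiantsHypothesis.ValiantsHypothesis.Theorems.KPlusLogSqLaw
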